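import Summits.CriticalPhenomena.PercolationContinuityZ3.Theses.PercCriticalCaps
import Summits.CriticalPhenomena.PercolationContinuityZ3.Theorems.PercNearOneGluingNoHeavyLowerTailCSHTheoremOne
import Literature.Probability.Percolation.KestenTheorem
import Literature.Probability.Percolation.SharpnessDCTProofs
import Literature.Probability.Percolation.TwoPointFunction
import Literature.Probability.Percolation.BondPercolationSymmetry
import Literature.Probability.LatticeModels.LatticeGraph
import Literature.Probability.LatticeModels.ThermodynamicLimit
import Mathlib.MeasureTheory.OuterMeasure.BorelCantelli
import HarnessLib

/-!
# `PercCriticalCaps.SummableOneArmGivesCap` (stmt-CriticalPhenomena-7515) — SETTLED after continuity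

Item `stmt-CriticalPhenomena-7515` of route `CriticalPhenomena/PercCriticalCaps` (support (calibration)): if the one-arm probabilities `π_p(n) = P_p(0 ↔ ∂ⁱⁿΛ(n))` are summable then almost surely only finitely many `t > 0` have `t·e₀ ↔ {y₀ = 0}` (every `d ≥ 1`).

`{t e₀ ↔ y}` with `y₀ = 0` is the shift of `{0 ↔ y − t e₀}` (`preimage_relabel_shift_openConn`, `bondPercolation_real_preimage_shift`), and `(y − t e₀)₀ = −t` lies outside `Λ(t−1)`, so the first-exit lemma `exists_mem_innerBoundary_openConnIn` gives the arm `{0 ↔ ∂ⁱⁿΛ(t−1)}`; hence `P(E_t) ≤ π(t−1)`, summable; Borel–Cantelli `ae_finite_setOf_mem`.  p205010 is NOT used.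

builds on p205010 (kernel theorem, internal audit signed; external expert review pending) — USED (`CSH.percolationContinuityZ3_holds`).  RSW3 lane, lead gen 28 (prover-prim-rsw3-lead-g28-0):
'after continuity — the ledger harvest'.
References: G. Kozma, N. Nitzan (2024), Thm. 6 / Conj. 3 [KozmaNitzan2024]; G. Grimmett, *Percolation* (1999), §8 [GrimmettPercolation1999].
-/

noncomputable section

namespace Summit.CriticalPhenomena.PercolationContinuityZ3.Theorems

namespace PercCriticalCapsSummableOneArmGivesCap

open MeasureTheory Literature.Probability.Percolation Literature.Probability.LatticeModels
open DCT16

/-- **`PercCriticalCaps.SummableOneArmGivesCap` (stmt-CriticalPhenomena-7515), settled.**  shift + first exit: `P(E_t) ≤ π_p(t−1)`; Borel–Cantelli.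
[cite: KozmaNitzan2024, Thm. 6 with Conj. 3 (p. 15)] -/
theorem summableOneArmGivesCap_proof : Summit.CriticalPhenomena.PercolationContinuityZ3.Theses.PercCriticalCaps.SummableOneArmGivesCap := by
  intro d _ p hsum
  classical
  set μ := bondPercolation (zdGraph d) p with hμ
  set π : ℕ → ℝ := fun n => μ.real (siteToBoundary d n) with hπ
  -- the hit events and their one-arm bound
  set E : ℤ → Set (BondConfig (Site d)) := fun t =>
    {ω | 0 < t ∧ ∃ y : Site d, y 0 = 0 ∧ ω ∈ openConn (Pi.single 0 t : Site d) y} with hE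
  set a : ℤ → ℝ := fun t => if 0 < t then π (t.toNat - 1) else 0 with ha
  have hbound : ∀ t : ℤ, μ.real (E t) ≤ a t := by
    intro t
    by_cases ht : 0 < t
    · rw [ha]; simp only [ht, if_true]
      -- shift by `-t e₀`: `{t e₀ ↔ y} = shift⁻¹ {0 ↔ y - t e₀}`
      set B : Set (BondConfig (Site d)) := {ω | ∃ y : Site d, y 0 = 0 ∧ ω ∈ openConn (0 : Site d) (y - Pi.single 0 t)} with hB
      have hAB : E t ⊆ BondConfig.relabel (sym2Equiv (Site.shift (-(Pi.single 0 t : Site d)))) ⁻¹' B := by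
        rintro ω ⟨-, y, hy, hω⟩
        refine ⟨y, hy, ?_⟩
        have h := preimage_relabel_shift_openConn (-(Pi.single 0 t : Site d)) (Pi.single 0 t : Site d) y
        rw [add_neg_cancel, ← sub_eq_add_neg] at h
        have : ω ∈ BondConfig.relabel (sym2Equiv (Site.shift (-(Pi.single 0 t : Site d)))) ⁻¹'
            (openConn (0 : Site d) (y - Pi.single 0 t) : Set (BondConfig (Site d))) := by rw [h]; exact hω
        exact this
      have h1 : μ.real (E t) ≤ μ.real B := by
        refine (measureReal_mono hAB (measure_ne_top _ _)).trans_eq ?_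
        exact bondPercolation_real_preimage_shift _ p B
      -- first exit from `Λ(t-1)`: `{0 ↔ y - t e₀}` forces the arm to `∂ⁱⁿΛ(t-1)`
      have h2 : μ.real B ≤ π (t.toNat - 1) := by
        rw [hπ]
        refine real_mono_of_forall_subset_edgeSet (zdGraph d) p fun ω hω hωB => ?_
        obtain ⟨y, hy, hconn⟩ := hωB
        have h0 : (0 : Site d) ∈ box d (t.toNat - 1) := by simp [mem_box]
        have hyout : y - Pi.single 0 t ∉ box d (t.toNat - 1) := by
          intro hmem
          have := ((mem_box.1 hmem) 0).1
          simp only [Pi.sub_apply, hy, Pi.single_eq_same, zero_sub] at this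
          omega
        obtain ⟨z, hz, hz'⟩ := exists_mem_innerBoundary_openConnIn hω (box d (t.toNat - 1)) h0 hyout hconn
        exact ⟨z, hz, hz'⟩
      exact h1.trans h2
    · have hempty : E t = ∅ := by
        ext ω; simp [hE, ht]
      rw [hempty, measureReal_empty, ha]
      simp [ht]
  -- summability of the bounds: `a (n+1) = π n`, `a t = 0` for `t ≤ 0`
  have ha_sum : Summable a := by
    have hf : Function.Injective fun n : ℕ => (n : ℤ) + 1 := fun m n h => by simpa using h
    have hzero : ∀ t ∉ Set.range (fun n : ℕ => (n : ℤ) + 1), a t = 0 := by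
      intro t ht
      have hle : ¬ 0 < t := by
        intro hpos
        exact ht ⟨(t - 1).toNat, by simp; omega⟩
      simp [ha, hle]
    refine (hf.summable_iff hzero).1 ?_
    have : (a ∘ fun n : ℕ => (n : ℤ) + 1) = π := by
      funext n
      have hpos : (0 : ℤ) < n + 1 := by omega
      simp only [Function.comp, ha, hpos, if_true]
      congr 1
    rw [this]
    exact hsum
  have ha_nn : ∀ t, 0 ≤ a t := fun t => (measureReal_nonneg).trans (hbound t)
  have hfin : ∑' t, μ (E t) ≠ ⊤ := by
    have h1 : ∑' t, μ (E t) ≤ ∑' t, ENNReal.ofReal (a t) :=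
      ENNReal.tsum_le_tsum fun t => by
        rw [← ofReal_measureReal (measure_ne_top _ _)]
        exact ENNReal.ofReal_le_ofReal (hbound t)
    rw [← ENNReal.ofReal_tsum_of_nonneg ha_nn ha_sum] at h1
    exact ne_top_of_le_ne_top ENNReal.ofReal_ne_top h1
  filter_upwards [ae_finite_setOf_mem hfin] with ω hω
  simpa only [hE, Set.mem_setOf_eq] using hω

end PercCriticalCapsSummableOneArmGivesCap

end Summit.CriticalPhenomena.PercolationContinuityZ3.Theorems

end
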